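import Summits.HodgeConjecture.HodgeConjecture.Theorems.R90S4StableConjOfNormClassesLeTwo   -- ★ p863701 (this seat): `det_hermStar_mul_self`, the odd-degree trick (brings ★ `CartanRealisation`, ★ `CartanAlgebra`)
import Literature.NumberTheory.Rogawski1990.CartanTorusTransport                            -- ★ (B5): `hermStar_mul_hermStar_coe_inv` (`t⋆ (t⁻¹)⋆ = 1`)
import HarnessLib

/-!
# R90-TF · S4 «Ch. 13.1–2», (DICT) sub-brick (2), FILE 1 — AT MOST TWO CLASSES FROM A FOUR-ELEMENT NORM-CLASS STRUCTURE: if the `⋆`-fixed units of `Z(γ)` are covered by the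
# four classes `{1, r₀·1, k₀, r₀·k₀}`, every stable conjugate of `γ` is conjugate to `γ` or to ONE fixed `δ₀ = g₀γg₀⁻¹` (Rogawski 1990, §3.5 Prop. 3.5.2 pp. 25–26, §3.6 pp. 28–29)

Cell `hodgecm-mathlib`, crux H413 (`stmt-HodgeConjecture-24833`, lane `--supports … --as helper`), route of record `HCCMUnconditional` (no route verbs; count-neutral).
Programme R90-TF, section S4, dealer K2E2-plan (g7): deal «(DICT)(2) `K¹ × E¹`» (`R90/STATUS.md` 2026-09-05T00:55:10Z), census R0 01:10:48Z (F1 «TYPE-TWO CLASS COUNT», arithmetic-free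
half); seat K2E3-p27 (g3).  GENERIC half (any field `K`, involution `σ`, `σ`-hermitian invertible `H ∈ M₃(K)`), the type-(2) twin of ★ FILE 1 `R90S4StableConjOfNormClassesLeTwo`;
the type-(2) structure letters (`k₀`, the four-class cover) and the `Gqs L v` instance are the sequels.  THEOREMS ONLY — no `def`, no instance, no notation, no `sorry`; ★-only imports.

## THE MATHEMATICS
`U = U(H)(K)`, `⋆ = hermStar σ H`, `γ ∈ U` regular, `Z = Z(γ)` its Cartan algebra (★ `cartanAlgebra`), `x_g = H⁻¹H_g ∈ Z` the class of a stable conjugator (`⋆`-fixed, `det x_g = N(det g)`,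
★ `det_inv_mul_twistGram`).  HYPOTHESES: `r₀` a `σ`-fixed non-norm scalar; a matrix `k₀`; (COVER) every `⋆`-fixed unit `x ∈ Z` satisfies `x·(t⋆t) ∈ {1, r₀·1, k₀, r₀·k₀}` for some
invertible `t ∈ Z` — «`H¹(F,T) = (Z^⋆)ˣ ∕ N` has at most the four classes `1, r₀, k₀, r₀k₀`», the shape of a type-(2) torus `T_K × E¹` (`H¹ ≅ F^×∕N_E × K^×∕N_{KE∕K} ≅ (ℤ∕2)²`,
[Prop. 3.5.2]); and ONE stable conjugator `g₀` (`δ₀ = g₀γg₀⁻¹ ∈ U`) whose class `x_{g₀}` is NOT killed by a `⋆`-norm.  CONCLUSION **`exists_unitary_conj_or_of_normClasses_four`**: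
every stable conjugate `δ = gγg⁻¹ ∈ U` is `U`-conjugate to `γ` OR to `δ₀`.  PROOF (determinant parity, no explicit determinant formula on `Z`): by (COVER) `x_g·(t⋆t) = c·1` or
`c·k₀` with `c ∈ {1, r₀}`; `c·1` with `c = 1` ⇒ `δ ∼ γ` (★ `exists_unitary_conj_iff_exists_norm_eq`); `c·1` with `c = r₀` is impossible (`N(det g·det t) = r₀³`, odd degree,
★ FILE 1); the same for `x_{g₀}` leaves only `x_{g₀}·(t₀⋆t₀) = c₀·k₀`; if `c = c₀` then `H_g = H_{g₀ s}` with `s = t₀t⁻¹ ∈ Z` and ★ `exists_unitary_conj_of_twistGram_eq` gives `δ ∼ δ₀`;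
if `c ≠ c₀` then `{c, c₀} = {1, r₀}` and the two determinant identities give `N(q) = r₀³` — impossible.  Hence AT MOST TWO classes; that they are TWO (`δ₀ ≁ γ`) is the criterion
read backwards (`x_{g₀}` not killed), **`not_exists_unitary_conj_of_not_killed`**.  With the REALISATION of a non-killed class with norm determinant (★ `exists_twistGram_eq_mul_iff_det`,
local) this is «EXACTLY n = 2 classes» for type (2) [§3.6: `|𝔇(T∕F)| = 2`]; that and the type-(2) structure letters are the sequel files.

## CONTENTS
* §1 `mul_map_ne_pow_three` (`q·σq ≠ r₀³`), `inv_coe_mem_cartanAlgebra`, `twistGram_eq_twistGram_mul_of_mul_norm_eq` (equal classes up to norms ⇒ `H_g = H_{g₀s}`),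
  **`not_exists_unitary_conj_of_not_killed`**, **`exists_unitary_conj_or_of_normClasses_four`**.

HONEST LABEL: HC_CM is proved only modulo the 7 printed citations (2 remaining named inputs: hLiu418 = stmt-HodgeConjecture-24832, h413 = stmt-HodgeConjecture-24833) until rung 0
closes.  Generic algebra toward the (DICT) payer of (B2-S); discharges no named input; (W-NP) ∕ (B1) OPEN.  REL ≠ ★ ≠ BUILT.

## References
* [Rogawski1990] J. D. Rogawski, *Automorphic Representations of Unitary Groups in Three Variables*, Ann. of Math. Stud. 123 (1990), §3.1 p. 19, §3.5 Prop. 3.5.2 pp. 25–26, §3.6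
  pp. 28–29 (type (2): `T_K × E¹`, `𝓡(T∕F) ≅ ℤ∕2`).
* [Kottwitz1986] R. E. Kottwitz, *Stable trace formula: elliptic singular terms*, Math. Ann. 275 (1986), §7.
-/

set_option autoImplicit false
set_option linter.dupNamespace false

noncomputable section

open scoped Matrix MatrixGroups
open Literature.NumberTheory.Rogawski1990
open Literature.AlgebraicGeometry.ShimuraVarieties (unitaryGroup mem_unitaryGroup_iff)

namespace Summit.HodgeConjecture.HodgeConjecture.R90.S4

section Generic

variable {K : Type*} [Field K] (σ : K →+* K) {H : Matrix (Fin 3) (Fin 3) K}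

/-- `q·σq ≠ r₀³` for a `σ`-fixed non-norm `r₀` (else `(q∕r₀)·σ(q∕r₀) = r₀`): the odd-degree obstruction. [cite: Rogawski1990, §3.6 p. 28] -/
theorem mul_map_ne_pow_three {r₀ : K} (hr₀σ : σ r₀ = r₀) (hr₀n : ∀ z : K, z * σ z ≠ r₀) (q : K) : q * σ q ≠ r₀ ^ 3 := by
  intro h
  have hr0 : r₀ ≠ 0 := fun h0 => hr₀n 0 (by rw [zero_mul, h0])
  refine hr₀n (q * r₀⁻¹) ?_
  rw [map_mul, map_inv₀, hr₀σ, show q * r₀⁻¹ * (σ q * r₀⁻¹) = q * σ q * (r₀⁻¹ * r₀⁻¹) by ring, h]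
  field_simp

/-- The inverse of an invertible element of `Z(γ)` lies in `Z(γ)`. [folklore] -/
theorem inv_coe_mem_cartanAlgebra {γ : Matrix (Fin 3) (Fin 3) K} {t : GL (Fin 3) K} (ht : (t : Matrix (Fin 3) (Fin 3) K) ∈ cartanAlgebra γ) :
    ((t⁻¹ : GL (Fin 3) K) : Matrix (Fin 3) (Fin 3) K) ∈ cartanAlgebra γ := by
  rw [mem_cartanAlgebra_iff] at ht ⊢
  exact ht.units_inv_left

/-- **Equal classes modulo norms give the same transported form**: for stable conjugators `g, g₀` of the regular `γ ∈ U(H)(K)` with `x_g·(t⋆t) = x_{g₀}·(t₀⋆t₀)` (`t, t₀ ∈ Z(γ)`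
invertible), `H_g = H_{g₀ s}` with `s = t₀ t⁻¹` — the input of ★ `exists_unitary_conj_of_twistGram_eq`. [cite: Rogawski1990, §3.1 p. 19; §3.5 Prop. 3.5.2 p. 25] -/
theorem twistGram_eq_twistGram_mul_of_mul_norm_eq (hH : IsUnit H.det) {γ : ↥(unitaryGroup σ H)}
    (hsep : ((γ : GL (Fin 3) K) : Matrix (Fin 3) (Fin 3) K).charpoly.Separable) {g g₀ t t₀ : GL (Fin 3) K} {δ δ₀ : GL (Fin 3) K}
    (hg : g * (γ : GL (Fin 3) K) * g⁻¹ = δ) (hg₀ : g₀ * (γ : GL (Fin 3) K) * g₀⁻¹ = δ₀) (hδ : δ ∈ unitaryGroup σ H) (hδ₀ : δ₀ ∈ unitaryGroup σ H)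
    (ht : (t : Matrix (Fin 3) (Fin 3) K) ∈ cartanAlgebra ((γ : GL (Fin 3) K) : Matrix (Fin 3) (Fin 3) K))
    (ht₀ : (t₀ : Matrix (Fin 3) (Fin 3) K) ∈ cartanAlgebra ((γ : GL (Fin 3) K) : Matrix (Fin 3) (Fin 3) K))
    (h : H⁻¹ * twistGram σ H (g : Matrix (Fin 3) (Fin 3) K) * (hermStar σ H t * t) =
      H⁻¹ * twistGram σ H (g₀ : Matrix (Fin 3) (Fin 3) K) * (hermStar σ H t₀ * t₀)) :
    twistGram σ H (g : Matrix (Fin 3) (Fin 3) K) = twistGram σ H ((g₀ * (t₀ * t⁻¹) : GL (Fin 3) K) : Matrix (Fin 3) (Fin 3) K) := by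
  set Z := cartanAlgebra ((γ : GL (Fin 3) K) : Matrix (Fin 3) (Fin 3) K)
  have hcomm : ∀ a b : Matrix (Fin 3) (Fin 3) K, a ∈ Z → b ∈ Z → a * b = b * a := fun a b ha hb => mul_comm_of_mem_cartanAlgebra hsep ha hb
  have hxZ : H⁻¹ * twistGram σ H (g : Matrix (Fin 3) (Fin 3) K) ∈ Z :=
    inv_mul_twistGram_mem_cartanAlgebra σ H hH (γ := γ) (δ := ⟨δ, hδ⟩) hg
  have hx₀Z : H⁻¹ * twistGram σ H (g₀ : Matrix (Fin 3) (Fin 3) K) ∈ Z :=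
    inv_mul_twistGram_mem_cartanAlgebra σ H hH (γ := γ) (δ := ⟨δ₀, hδ₀⟩) hg₀
  have htsZ : hermStar σ H (t : Matrix (Fin 3) (Fin 3) K) ∈ Z := hermStar_mem_cartanAlgebra σ H hH γ.2 ht
  have ht₀sZ : hermStar σ H (t₀ : Matrix (Fin 3) (Fin 3) K) ∈ Z := hermStar_mem_cartanAlgebra σ H hH γ.2 ht₀
  -- `H⁻¹ H_{g₀ (t₀ t⁻¹)} = (t⁻¹)⋆ (t₀⋆ x₀ t₀) t⁻¹ = (t⁻¹)⋆ (t⋆ x t) t⁻¹ = x = H⁻¹ H_g`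
  have key : H⁻¹ * twistGram σ H ((g₀ * (t₀ * t⁻¹) : GL (Fin 3) K) : Matrix (Fin 3) (Fin 3) K) = H⁻¹ * twistGram σ H (g : Matrix (Fin 3) (Fin 3) K) := by
    have e1 : hermStar σ H (t₀ : Matrix (Fin 3) (Fin 3) K) * (H⁻¹ * twistGram σ H (g₀ : Matrix (Fin 3) (Fin 3) K)) * (t₀ : Matrix (Fin 3) (Fin 3) K) =
        H⁻¹ * twistGram σ H (g₀ : Matrix (Fin 3) (Fin 3) K) * (hermStar σ H t₀ * t₀) := by
      rw [hcomm _ _ ht₀sZ hx₀Z, Matrix.mul_assoc]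
    have e2 : hermStar σ H (t : Matrix (Fin 3) (Fin 3) K) * (H⁻¹ * twistGram σ H (g : Matrix (Fin 3) (Fin 3) K)) * (t : Matrix (Fin 3) (Fin 3) K) =
        H⁻¹ * twistGram σ H (g : Matrix (Fin 3) (Fin 3) K) * (hermStar σ H t * t) := by
      rw [hcomm _ _ htsZ hxZ, Matrix.mul_assoc]
    rw [Units.val_mul, Units.val_mul, inv_mul_twistGram_mul σ H hH, hermStar_mul σ H hH]
    calc hermStar σ H ((t⁻¹ : GL (Fin 3) K) : Matrix (Fin 3) (Fin 3) K) * hermStar σ H (t₀ : Matrix (Fin 3) (Fin 3) K) *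
          (H⁻¹ * twistGram σ H (g₀ : Matrix (Fin 3) (Fin 3) K)) * ((t₀ : Matrix (Fin 3) (Fin 3) K) * ((t⁻¹ : GL (Fin 3) K) : Matrix (Fin 3) (Fin 3) K))
        = hermStar σ H ((t⁻¹ : GL (Fin 3) K) : Matrix (Fin 3) (Fin 3) K) *
            (hermStar σ H (t₀ : Matrix (Fin 3) (Fin 3) K) * (H⁻¹ * twistGram σ H (g₀ : Matrix (Fin 3) (Fin 3) K)) * (t₀ : Matrix (Fin 3) (Fin 3) K)) *
            ((t⁻¹ : GL (Fin 3) K) : Matrix (Fin 3) (Fin 3) K) := by simp only [Matrix.mul_assoc]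
      _ = hermStar σ H ((t⁻¹ : GL (Fin 3) K) : Matrix (Fin 3) (Fin 3) K) *
            (hermStar σ H (t : Matrix (Fin 3) (Fin 3) K) * (H⁻¹ * twistGram σ H (g : Matrix (Fin 3) (Fin 3) K)) * (t : Matrix (Fin 3) (Fin 3) K)) *
            ((t⁻¹ : GL (Fin 3) K) : Matrix (Fin 3) (Fin 3) K) := by rw [e1, ← h, ← e2]
      _ = (hermStar σ H ((t⁻¹ : GL (Fin 3) K) : Matrix (Fin 3) (Fin 3) K) * hermStar σ H (t : Matrix (Fin 3) (Fin 3) K)) *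
            (H⁻¹ * twistGram σ H (g : Matrix (Fin 3) (Fin 3) K)) * ((t : Matrix (Fin 3) (Fin 3) K) * ((t⁻¹ : GL (Fin 3) K) : Matrix (Fin 3) (Fin 3) K)) := by
          simp only [Matrix.mul_assoc]
      _ = H⁻¹ * twistGram σ H (g : Matrix (Fin 3) (Fin 3) K) := by
          rw [← hermStar_mul σ H hH, ← Units.val_mul, mul_inv_cancel, Units.val_one, hermStar_one σ H hH, Matrix.one_mul, Matrix.mul_one]
  have hfinal := congrArg (fun X => H * X) key
  simpa only [Matrix.mul_nonsing_inv_cancel_left _ _ hH] using hfinal.symm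

/-- **A stable conjugate whose class is not killed by a `⋆`-norm is NOT `U(H)(K)`-conjugate to `γ`** (the criterion ★ `exists_unitary_conj_iff_exists_norm_eq`, read backwards).
[cite: Rogawski1990, §3.5 Prop. 3.5.2 p. 25] -/
theorem not_exists_unitary_conj_of_not_killed (hH : IsUnit H.det) {γ δ₀ : ↥(unitaryGroup σ H)}
    (hsep : ((γ : GL (Fin 3) K) : Matrix (Fin 3) (Fin 3) K).charpoly.Separable) {g₀ : GL (Fin 3) K} (hg₀ : g₀ * (γ : GL (Fin 3) K) * g₀⁻¹ = δ₀)
    (hg₀n : ¬ ∃ t : GL (Fin 3) K, (t : Matrix (Fin 3) (Fin 3) K) ∈ cartanAlgebra ((γ : GL (Fin 3) K) : Matrix (Fin 3) (Fin 3) K) ∧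
      H⁻¹ * twistGram σ H (g₀ : Matrix (Fin 3) (Fin 3) K) * (hermStar σ H t * t) = 1) :
    ¬ ∃ u : GL (Fin 3) K, u ∈ unitaryGroup σ H ∧ u * (γ : GL (Fin 3) K) * u⁻¹ = δ₀ := by
  rw [exists_unitary_conj_iff_exists_norm_eq σ H hH hsep hg₀]
  rintro ⟨t, ht, hkill⟩
  refine hg₀n ⟨t, ?_, hkill⟩
  rw [mem_cartanAlgebra_iff, Commute, SemiconjBy, ← Units.val_mul, ← Units.val_mul, ht]

/-- **AT MOST TWO CLASSES FROM THE FOUR-CLASS COVER.**  `K` a field with involution `σ`, `H ∈ M₃(K)` `σ`-hermitian invertible, `γ ∈ U(H)(K)` regular, `Z = Z(γ)`; `r₀` a `σ`-fixed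
non-norm scalar, `k₀` any matrix (in practice a `⋆`-fixed unit of `Z`); (COVER) `hcov`: every `⋆`-fixed unit `x ∈ Z` has `x·(t⋆t) ∈ {1, r₀·1, k₀, r₀·k₀}` for some invertible `t ∈ Z`; `δ₀ = g₀γg₀⁻¹ ∈ U(H)(K)` a stable conjugate
whose class `x_{g₀} = H⁻¹H_{g₀}` is not killed by a `⋆`-norm (`hg₀n`).  Then every stable conjugate `δ = gγg⁻¹ ∈ U(H)(K)` is `U(H)(K)`-conjugate to `γ` or to `δ₀` — the type-(2)
count `|𝔇(T∕F)| ≤ 2` by determinant parity (module docstring). [cite: Rogawski1990, §3.5 Prop. 3.5.2 pp. 25–26; §3.6 pp. 28–29] [cite: Kottwitz1986, §7] -/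
theorem exists_unitary_conj_or_of_normClasses_four (hH : IsUnit H.det) (hσ : ∀ r : K, σ (σ r) = r) (hHh : (H.map σ)ᵀ = H)
    {r₀ : K} (hr₀σ : σ r₀ = r₀) (hr₀n : ∀ z : K, z * σ z ≠ r₀)
    {γ δ₀ δ : ↥(unitaryGroup σ H)} (hsep : ((γ : GL (Fin 3) K) : Matrix (Fin 3) (Fin 3) K).charpoly.Separable)
    {k₀ : Matrix (Fin 3) (Fin 3) K}
    (hcov : ∀ x : Matrix (Fin 3) (Fin 3) K, x ∈ cartanAlgebra ((γ : GL (Fin 3) K) : Matrix (Fin 3) (Fin 3) K) → hermStar σ H x = x → IsUnit x.det →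
      ∃ t : GL (Fin 3) K, (t : Matrix (Fin 3) (Fin 3) K) ∈ cartanAlgebra ((γ : GL (Fin 3) K) : Matrix (Fin 3) (Fin 3) K) ∧
        (x * (hermStar σ H t * t) = 1 ∨ x * (hermStar σ H t * t) = r₀ • (1 : Matrix (Fin 3) (Fin 3) K) ∨
          x * (hermStar σ H t * t) = k₀ ∨ x * (hermStar σ H t * t) = r₀ • k₀))
    {g₀ : GL (Fin 3) K} (hg₀ : g₀ * (γ : GL (Fin 3) K) * g₀⁻¹ = δ₀)
    (hg₀n : ¬ ∃ t : GL (Fin 3) K, (t : Matrix (Fin 3) (Fin 3) K) ∈ cartanAlgebra ((γ : GL (Fin 3) K) : Matrix (Fin 3) (Fin 3) K) ∧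
      H⁻¹ * twistGram σ H (g₀ : Matrix (Fin 3) (Fin 3) K) * (hermStar σ H t * t) = 1)
    {g : GL (Fin 3) K} (hg : g * (γ : GL (Fin 3) K) * g⁻¹ = δ) :
    (∃ u : GL (Fin 3) K, u ∈ unitaryGroup σ H ∧ u * (γ : GL (Fin 3) K) * u⁻¹ = δ) ∨
      (∃ u : GL (Fin 3) K, u ∈ unitaryGroup σ H ∧ u * (δ₀ : GL (Fin 3) K) * u⁻¹ = δ) := by
  set Z := cartanAlgebra ((γ : GL (Fin 3) K) : Matrix (Fin 3) (Fin 3) K) with hZ_def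
  -- the two class invariants
  set x : Matrix (Fin 3) (Fin 3) K := H⁻¹ * twistGram σ H (g : Matrix (Fin 3) (Fin 3) K) with hx_def
  set x₀ : Matrix (Fin 3) (Fin 3) K := H⁻¹ * twistGram σ H (g₀ : Matrix (Fin 3) (Fin 3) K) with hx₀_def
  have hxZ : x ∈ Z := inv_mul_twistGram_mem_cartanAlgebra σ H hH hg
  have hx₀Z : x₀ ∈ Z := inv_mul_twistGram_mem_cartanAlgebra σ H hH hg₀
  have hxs : hermStar σ H x = x := hermStar_inv_mul_twistGram σ H hH hσ hHh _
  have hx₀s : hermStar σ H x₀ = x₀ := hermStar_inv_mul_twistGram σ H hH hσ hHh _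
  set a : K := (g : Matrix (Fin 3) (Fin 3) K).det with ha_def
  set a₀ : K := (g₀ : Matrix (Fin 3) (Fin 3) K).det with ha₀_def
  have hxd : x.det = σ a * a := det_inv_mul_twistGram σ H hH _
  have hx₀d : x₀.det = σ a₀ * a₀ := det_inv_mul_twistGram σ H hH _
  have ha0 : a ≠ 0 := (Matrix.isUnits_det_units g).ne_zero
  have ha₀0 : a₀ ≠ 0 := (Matrix.isUnits_det_units g₀).ne_zero
  have hxu : IsUnit x.det := by rw [hxd]; exact (((map_ne_zero σ).2 ha0).isUnit).mul ha0.isUnit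
  have hx₀u : IsUnit x₀.det := by rw [hx₀d]; exact (((map_ne_zero σ).2 ha₀0).isUnit).mul ha₀0.isUnit
  have h3 := mul_map_ne_pow_three σ hr₀σ hr₀n
  -- membership `t ∈ Z(γ)` versus `t γ = γ t`
  have hmem : ∀ t : GL (Fin 3) K, (t : Matrix (Fin 3) (Fin 3) K) ∈ Z ↔ t * (γ : GL (Fin 3) K) = γ * t := by
    intro t
    rw [hZ_def, mem_cartanAlgebra_iff, Commute, SemiconjBy, ← Units.val_mul, ← Units.val_mul, Units.val_inj]
  -- determinants of the four shapes
  have hdet : ∀ {y : Matrix (Fin 3) (Fin 3) K} {b : K} (t : GL (Fin 3) K), y.det = σ b * b →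
      (y * (hermStar σ H t * t)).det = σ (b * (t : Matrix (Fin 3) (Fin 3) K).det) * (b * (t : Matrix (Fin 3) (Fin 3) K).det) := by
    intro y b t hy
    rw [Matrix.det_mul, det_hermStar_mul_self σ hH, hy, map_mul]
    ring
  -- the scalar shape `r₀·1` is impossible for a class with norm determinant
  have hscal : ∀ {y : Matrix (Fin 3) (Fin 3) K} {b : K} (t : GL (Fin 3) K), y.det = σ b * b →
      y * (hermStar σ H t * t) ≠ r₀ • (1 : Matrix (Fin 3) (Fin 3) K) := by
    intro y b t hy heq
    have h1 := hdet t hy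
    rw [heq, Matrix.det_smul, Matrix.det_one, mul_one, Fintype.card_fin] at h1
    exact h3 (b * (t : Matrix (Fin 3) (Fin 3) K).det) (by rw [mul_comm]; exact h1.symm)
  obtain ⟨t, htZ, hcases⟩ := hcov x hxZ hxs hxu
  rcases hcases with h1 | h1 | h1 | h1
  · -- `x·(t⋆t) = 1`: `δ ∼ γ`
    left
    exact (exists_unitary_conj_iff_exists_norm_eq σ H hH hsep hg).2 ⟨t, (hmem t).1 htZ, h1⟩
  · exact absurd h1 (hscal t hxd)
  all_goals
    -- the class of `g₀` has the shape `c₀·k₀`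
    obtain ⟨t₀, ht₀Z, hcases₀⟩ := hcov x₀ hx₀Z hx₀s hx₀u
    rcases hcases₀ with h2 | h2 | h2 | h2
    · exact absurd ⟨t₀, ht₀Z, h2⟩ hg₀n
    · exact absurd h2 (hscal t₀ hx₀d)
  -- four remaining combinations: (k₀, k₀), (k₀, r₀k₀), (r₀k₀, k₀), (r₀k₀, r₀k₀)
  · -- `x·(t⋆t) = k₀ = x₀·(t₀⋆t₀)`: `δ ∼ δ₀`
    right
    have hform := twistGram_eq_twistGram_mul_of_mul_norm_eq σ hH hsep hg hg₀ δ.2 δ₀.2 htZ ht₀Z (h1.trans h2.symm)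
    have hs : (t₀ * t⁻¹ : GL (Fin 3) K) * (γ : GL (Fin 3) K) = γ * (t₀ * t⁻¹) :=
      (hmem _).1 (Subalgebra.mul_mem _ ht₀Z (inv_coe_mem_cartanAlgebra htZ))
    obtain ⟨u, hu, huc⟩ := exists_unitary_conj_of_twistGram_eq σ H hg₀ hg hs hform
    refine ⟨u⁻¹, Subgroup.inv_mem _ hu, ?_⟩
    rw [← huc]; group
  · -- `x·(t⋆t) = k₀`, `x₀·(t₀⋆t₀) = r₀·k₀`: determinant parity contradiction
    exfalso
    have e1 := hdet t hxd
    have e2 := hdet t₀ hx₀d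
    rw [h1] at e1
    rw [h2, Matrix.det_smul, Fintype.card_fin, e1] at e2
    -- e2 : σ (a₀ d₀) (a₀ d₀) = r₀ ^ 3 * (σ (a d) (a d))
    set p : K := a * (t : Matrix (Fin 3) (Fin 3) K).det with hp
    set p₀ : K := a₀ * (t₀ : Matrix (Fin 3) (Fin 3) K).det with hp₀
    have hp0 : p ≠ 0 := mul_ne_zero ha0 (Matrix.isUnits_det_units t).ne_zero
    refine h3 (p₀ * p⁻¹) ?_
    have hσp0 : σ p ≠ 0 := (map_ne_zero σ).2 hp0
    rw [map_mul, map_inv₀, show p₀ * p⁻¹ * (σ p₀ * (σ p)⁻¹) = (σ p₀ * p₀) * (σ p * p)⁻¹ by ring, ← e2]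
    field_simp
  · -- `x·(t⋆t) = r₀·k₀`, `x₀·(t₀⋆t₀) = k₀`: the symmetric contradiction
    exfalso
    have e1 := hdet t hxd
    have e2 := hdet t₀ hx₀d
    rw [h2] at e2
    rw [h1, Matrix.det_smul, Fintype.card_fin, e2] at e1
    set p : K := a * (t : Matrix (Fin 3) (Fin 3) K).det with hp
    set p₀ : K := a₀ * (t₀ : Matrix (Fin 3) (Fin 3) K).det with hp₀
    have hp₀0 : p₀ ≠ 0 := mul_ne_zero ha₀0 (Matrix.isUnits_det_units t₀).ne_zero
    refine h3 (p * p₀⁻¹) ?_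
    have hσp0 : σ p₀ ≠ 0 := (map_ne_zero σ).2 hp₀0
    rw [map_mul, map_inv₀, show p * p₀⁻¹ * (σ p * (σ p₀)⁻¹) = (σ p * p) * (σ p₀ * p₀)⁻¹ by ring, ← e1]
    field_simp
  · -- `x·(t⋆t) = r₀·k₀ = x₀·(t₀⋆t₀)`: `δ ∼ δ₀`
    right
    have hform := twistGram_eq_twistGram_mul_of_mul_norm_eq σ hH hsep hg hg₀ δ.2 δ₀.2 htZ ht₀Z (h1.trans h2.symm)
    have hs : (t₀ * t⁻¹ : GL (Fin 3) K) * (γ : GL (Fin 3) K) = γ * (t₀ * t⁻¹) :=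
      (hmem _).1 (Subalgebra.mul_mem _ ht₀Z (inv_coe_mem_cartanAlgebra htZ))
    obtain ⟨u, hu, huc⟩ := exists_unitary_conj_of_twistGram_eq σ H hg₀ hg hs hform
    refine ⟨u⁻¹, Subgroup.inv_mem _ hu, ?_⟩
    rw [← huc]; group

end Generic

end Summit.HodgeConjecture.HodgeConjecture.R90.S4

end
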